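import Summits.QuantumFields.YangMills.Theorems.UnitScaleTiltProp8HalvingSiteAssembly
import HarnessLib

/-!
# Route `UnitScaleTilt`, crux K1 child «MinimiserStabilityRegPr» (stmt-QuantumFields-19200), registered stub V2′ `stub_halvingStep`
# (skeletons v8 5b4e846794b80374 / v10 pen `BirthV10`, OWNER RULING g24-№5 «w5∕w3 g2 = halving») — **THE (167)-CHART SCHEMA `H(L, B₃, K, a)` OF
# `Prop8LastMile` — HENCE THE REGISTERED STUB'S FULL TEXT — FROM THE P2 TEXT AND ONE ANALYTIC PACKAGE**: the package is, per member, minimiser and site,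
# the PIECES OF [Balaban1985Variational] (159) at the cube sequence centred at the site (chart on the one-point layer, `A = A₁ + HB − R`, the letters of `A₁` and
# `R` at size `Kᵢε₀²` ((165)–(166)), the near size `C₁ε₁(d+1)` ((160)) and far size `C₂ε₀L^{k−j}` ((155)) of the `𝔤`-valued datum `B`) — exactly the socket list
# of pillars P1 ([Balaban1985RegularSpaces] Thm 2 on the cube sequence, (152)–(156)), P3a ((157)), F4/P3b/P5 ((158)); with the P2 text `FlatOpsAdmAtMS` (✓ for odd
# `L ≥ 5` on big tori) it gives `H` with print's constants `B₃ := 4CB₀B₃`, `K := K₁ + K₂ + 1`, and then v8's `stub_halvingStep` text by w3 g0's `stubText_of_localCharts167`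

Cell `ym3-torus` (HUMAN RULING D-0037, YM ladder rung R3 — continuum SU(2) YM₃ on the torus is a RUNG, not the Clay problem), width seat
`ym-ust-19200-w3` gen 2 (D-0149).  `--supports stmt-QuantumFields-19200 --as helper`; def-free, 0 sorry, standard axioms.  NOTHING of the package is
proved here: it is the HYPOTHESIS whose clauses the pillar pens supply; this file is the kernel-checked bookkeeping «pieces ⟹ H ⟹ registered text».

THE PRINT ([Balaban1985Variational] p. 304): *«(165) … We take a largest absolute number a₅ such that M′ε₀ ≦ a₅ implies all the previous restrictions on
ε₀, and such that B₀(C₄ + 4C₂)(36dL²B₁R₁M₁)²a₅ ≦ ⅛. (166) If M′ε₀ ≦ a₅, then we get |A|, |∇^ηA|, |∂^{η*}∂^ηA|, |Δ^ηA| < ¼M_Δmax{B₃ε₁, ½ε₀} + ⅛M′ε₀ on Δ.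
(167)»*; p. 303 (162)–(163): *«B₃ depends on d and L only … We may assume that R₁M₁ is sufficiently big, so that B₃e^{−½δ₀R₁M₁} ≦ ½.»*

WHAT THIS FILE PROVES (no definition, no sorry):
* **`H_of_package`** — for a block size `L`, the P2 text `FlatOpsAdmAtMS L R₀ M₀ B₀ δ₀ B₃` (`B₀, δ₀, B₃ ≥ 0`), cube-sequence parameters `R ≥ R₀`, `M = L^{a_e} ≥ M₀`,
  `R·M ≤ S`, `ρ ≥ 2` with (163) `4CB₀B₃e^{−½δ₀(ρ−2)} ≤ ½`, constants `0 ≤ C₁`, `2C₁ ≤ C`, `C₂ ≤ C`, `K₁, K₂`, and the ANALYTIC PACKAGE at `(L; ρ, S, M; C₁, C₂, K₁, K₂; a)`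
  (verbatim in the statement) ⟹ `Prop8LastMile`'s `H(L, 4CB₀B₃, K₁ + K₂ + 1, a)` — the per-site step is `HalvingSiteAssembly.siteClause_of_pieces` at
  `α₂ = ¼max{4CB₀B₃ε₁, ½ε₀} + (K₁ + K₂ + 1)ε₀²` (strictness from `ε₀² > 0`).
* **`stubText_of_package`** — the REGISTERED TEXT of `stub_halvingStep` (v8∕v10 verbatim) from `∀ L > 1: P2 text ∧ package ∧ constants (1 < CB₀B₃ so that B₃′ > 4)`, by
  `Prop8LastMile.stubText_of_localCharts167`; and `prop8_of_package` — `Prop8Printed` at the carriers (v8's `landed_prop8` line).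
HONEST SCOPE: the package is a hypothesis (P1/P3a/F4/P3b/P5 content + the identification (156) of the datum fed to `H` with the log data whose near size is
`HalvingDatum160` and whose far size is (155)); the P2 text is a hypothesis (✓ `FlatPortBodyL0.body_of_adm22` for odd `L ≥ 5` on tori with `≥ 5L` big blocks;
(P2-L3)/(P2-small) open).  NOT a claim about the crux, the rung, or the mass gap.

References: T. Bałaban, CMP **102** (1985) 277–309 [Balaban1985Variational] (144) p.300, (152)–(159) pp.301–303, (160)–(168) pp.303–304, Prop. 8 p.304;
CMP **99** (1985) 75–102 [Balaban1985RegularSpaces] (1.140)–(1.144) p.100.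
-/

set_option autoImplicit false

noncomputable section

open scoped BigOperators Matrix.Norms.L2Operator

namespace Summit.QuantumFields.YangMills.Theorems.HalvingAssembly

open Literature.MathematicalPhysics.QuantumFieldTheory.Balaban1983to89
open Literature.MathematicalPhysics.QuantumFieldTheory.Balaban1983to89.T3ContinuumYM3Torus
open Literature.MathematicalPhysics.QuantumFieldTheory.Balaban1983to89.T3PrintedRegularMinimiser
open Literature.MathematicalPhysics.QuantumFieldTheory.Balaban1983to89.T3Thm1Carrier
open Literature.MathematicalPhysics.QuantumFieldTheory.Balaban1983to89.B11 (Prop8Printed)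
open Complex (I)
open B5Eq117TorusCarriers (Mk)
open B5Eq118OneStroke (iterBlockOf)
open B5Prop12FieldsLattice (distSite)
open B6SectAOperatorsV1 (BondIdx)
open B7Prop1Explicit (expUnit)
open B7Eq92Concrete (mgauge)
open B8Ineq132 (BondTouches)
open B8Eq140Level (SideTouches Cond140)
open B8Eq143PlaqExpansion (pdiv)
open B8Eq146AExpansion (plaqCovDeriv)
open B8Eq184Proof (cfgExp)
open B8Thm2SetupTorus (cfgPull gaugePull pullDom)
open B10Eq27TorusAxialLog (pull unitsField toUField transl)
open B11Eq115Space (levOf)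
open FlatCubeOpsText (Adm22 distBI IsLevWeight IsFlatH FlatOpsAdmAtMS HDecayLetterD)
open FlatCubeSequenceAligned (cubeSeqMT3)
open FlatCubeSequenceAdm (adm22_cubeSeqMT3)
open FlatOpsLettersAssembly (flatH isFlatH_flatH)
open HalvingSiteAssembly (siteClause_of_pieces)

/-! ## §1 `H` from the P2 text and the analytic package -/

section Member

variable {L R₀ M₀ : ℕ} {B₀ δ₀ B₃ : ℝ}

/-- **`H(L, 4CB₀B₃, K₁ + K₂ + 1, a)` FROM THE P2 TEXT AND THE ANALYTIC PACKAGE** (see the module docstring; the package `pkg` is displayed in full below: per member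
`F` with `F.L = L`, heights `n < K`, `0 < ε₁`, `0 < ε₀ ≤ a`, `4CB₀B₃ε₁ < ε₀`, (7)-datum `V`, minimiser `U` over (6)(ε₀) and site `x`, the pieces of (159) at
`D := cubeSeqMT3 F n K x ρ S M`). [cite: Balaban1985Variational, (159) p.303, (164)-(167) p.304; Balaban1985RegularSpaces, (1.140) p.100] -/
theorem H_of_package (hP2 : FlatOpsAdmAtMS L R₀ M₀ B₀ δ₀ B₃) (hB₀ : 0 ≤ B₀) (hδ₀ : 0 ≤ δ₀) (hB₃ : 0 ≤ B₃)
    {R M aₑ ρ S : ℕ} (hR : R₀ ≤ R) (hM₀ : M₀ ≤ M) (hMpow : M = L ^ aₑ) (hM1 : 1 ≤ M) (hRS : R * M ≤ S) (hρ2 : (2 : ℝ) ≤ (ρ : ℝ))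
    {C C₁ C₂ K₁ K₂ a : ℝ} (hC₁ : 0 ≤ C₁) (hC₁C : 2 * C₁ ≤ C) (hC₂C : C₂ ≤ C)
    (h163 : 4 * C * B₀ * B₃ * Real.exp (-(δ₀ / 2 * ((ρ : ℝ) - 2))) ≤ 1 / 2)
    (pkg : ∀ F : T3Family, F.L = L → ∀ (n K : ℕ) (hnK : n < K) (ε₀ ε₁ : ℝ), 0 < ε₁ → 0 < ε₀ → ε₀ ≤ a → 4 * C * B₀ * B₃ * ε₁ < ε₀ →
      ∀ V : GaugeField (F.P n) 0 (Matrix.specialUnitaryGroup (Fin 2) ℂ), PlaqSmall ε₁ V →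
        ∀ U ∈ regFibrePr F n K hnK.le ε₀ V,
          IsMinOn (fun W : GaugeField (F.P K) 0 (Matrix.specialUnitaryGroup (Fin 2) ℂ) => wilsonAction4 W) (regFibrePr F n K hnK.le ε₀ V) U →
          ∀ x : Site (F.P K) 0,
            ∃ (u : GaugeTransf (F.P K) 0 (Matrix.unitaryGroup (Fin 2) ℂ)) (A A₁ R : PBond (F.P K) 0 → Matrix (Fin 2) (Fin 2) ℂ)
              (B : BondIdx (cubeSeqMT3 F n K x ρ S M hM1) → Matrix (Fin 2) (Fin 2) ℂ),
              (∀ b : PBond (F.P K) 0, IsSelfAdjoint (A b)) ∧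
              (∀ (z : B7Prop1Explicit.Site (F.P K).d) (μ : Fin (F.P K).d),
                SideTouches (pullDom (fun j => if K - n ≤ j then ({x} : Set (Site (F.P K) 0)) else (∅ : Set (Site (F.P K) 0))) (K - n)) z μ →
                (Unitary.toUnits (u (transl 0 z)))⁻¹ * unitsField (toUField U) ⟨transl 0 z, μ⟩ * Unitary.toUnits (u ((transl 0 z).shift μ)) =
                  expUnit (I • ((((F.L : ℝ)⁻¹) ^ (K - n)) • A ⟨transl 0 z, μ⟩))) ∧
              (A = A₁ + (fun b => ∑ c, flatH F n K (cubeSeqMT3 F n K x ρ S M hM1) (Pi.single c 1) b • B c) - R) ∧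
              (∀ c : BondIdx (cubeSeqMT3 F n K x ρ S M hM1), (c.1.1 : ℕ) = K - n →
                ‖B c‖ ≤ C₁ * ε₁ * (distSite (Mk (F.P K) (c.1.1 : ℕ)) c.1.2.src (iterBlockOf (c.1.1 : ℕ) x) + 1)) ∧
              (∀ c : BondIdx (cubeSeqMT3 F n K x ρ S M hM1), (c.1.1 : ℕ) < K - n →
                ‖B c‖ ≤ C₂ * ε₀ * (F.L : ℝ) ^ ((K - n) - (c.1.1 : ℕ))) ∧
              (∀ (z : B7Prop1Explicit.Site (F.P K).d) (τ : Fin (F.P K).d),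
                SideTouches (pullDom (fun j => if K - n ≤ j then ({x} : Set (Site (F.P K) 0)) else (∅ : Set (Site (F.P K) 0))) (K - n)) z τ →
                ‖A₁ ⟨transl 0 z, τ⟩‖ ≤ K₁ * ε₀ ^ 2) ∧
              (∀ (z : B7Prop1Explicit.Site (F.P K).d) (κ τ : Fin (F.P K).d),
                SideTouches (pullDom (fun j => if K - n ≤ j then ({x} : Set (Site (F.P K) 0)) else (∅ : Set (Site (F.P K) 0))) (K - n)) z τ →
                ‖(((F.L : ℝ)⁻¹) ^ (K - n))⁻¹ • (A₁ ⟨(transl 0 z).shift κ, τ⟩ - A₁ ⟨transl 0 z, τ⟩)‖ ≤ K₁ * ε₀ ^ 2) ∧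
              (∀ (z : B7Prop1Explicit.Site (F.P K).d) (μ : Fin (F.P K).d),
                BondTouches (pullDom (fun j => if K - n ≤ j then ({x} : Set (Site (F.P K) 0)) else (∅ : Set (Site (F.P K) 0))) (K - n)) z μ →
                ‖pdiv (((F.L : ℝ)⁻¹) ^ (K - n)) (1 : B7Prop1Explicit.Site (F.P K).d → Fin (F.P K).d → (Matrix (Fin 2) (Fin 2) ℂ)ˣ)
                    (plaqCovDeriv (((F.L : ℝ)⁻¹) ^ (K - n)) (1 : B7Prop1Explicit.Site (F.P K).d → Fin (F.P K).d → (Matrix (Fin 2) (Fin 2) ℂ)ˣ)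
                      (pull A₁ 0)) μ z‖ ≤ K₁ * ε₀ ^ 2) ∧
              (∀ (z : B7Prop1Explicit.Site (F.P K).d) (τ : Fin (F.P K).d),
                SideTouches (pullDom (fun j => if K - n ≤ j then ({x} : Set (Site (F.P K) 0)) else (∅ : Set (Site (F.P K) 0))) (K - n)) z τ →
                ‖R ⟨transl 0 z, τ⟩‖ ≤ K₂ * ε₀ ^ 2) ∧
              (∀ (z : B7Prop1Explicit.Site (F.P K).d) (κ τ : Fin (F.P K).d),
                SideTouches (pullDom (fun j => if K - n ≤ j then ({x} : Set (Site (F.P K) 0)) else (∅ : Set (Site (F.P K) 0))) (K - n)) z τ →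
                ‖(((F.L : ℝ)⁻¹) ^ (K - n))⁻¹ • (R ⟨(transl 0 z).shift κ, τ⟩ - R ⟨transl 0 z, τ⟩)‖ ≤ K₂ * ε₀ ^ 2) ∧
              (∀ (z : B7Prop1Explicit.Site (F.P K).d) (μ : Fin (F.P K).d),
                BondTouches (pullDom (fun j => if K - n ≤ j then ({x} : Set (Site (F.P K) 0)) else (∅ : Set (Site (F.P K) 0))) (K - n)) z μ →
                ‖pdiv (((F.L : ℝ)⁻¹) ^ (K - n)) (1 : B7Prop1Explicit.Site (F.P K).d → Fin (F.P K).d → (Matrix (Fin 2) (Fin 2) ℂ)ˣ)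
                    (plaqCovDeriv (((F.L : ℝ)⁻¹) ^ (K - n)) (1 : B7Prop1Explicit.Site (F.P K).d → Fin (F.P K).d → (Matrix (Fin 2) (Fin 2) ℂ)ˣ)
                      (pull R 0)) μ z‖ ≤ K₂ * ε₀ ^ 2)) :
    ∀ F : T3Family, F.L = L → ∀ (n K' : ℕ) (hnK : n < K') (ε₀ ε₁ : ℝ), 0 < ε₁ → 0 < ε₀ → ε₀ ≤ a → 4 * C * B₀ * B₃ * ε₁ < ε₀ →
      ∀ V : GaugeField (F.P n) 0 (Matrix.specialUnitaryGroup (Fin 2) ℂ), PlaqSmall ε₁ V →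
        ∀ U ∈ regFibrePr F n K' hnK.le ε₀ V,
          IsMinOn (fun W : GaugeField (F.P K') 0 (Matrix.specialUnitaryGroup (Fin 2) ℂ) => wilsonAction4 W) (regFibrePr F n K' hnK.le ε₀ V) U →
          ∀ x : Site (F.P K') 0, ∃ (Ω : ℕ → Set (Site (F.P K') 0)) (u : GaugeTransf (F.P K') 0 (Matrix.unitaryGroup (Fin 2) ℂ))
            (A : GaugeField (F.P K') 0 (Matrix (Fin 2) (Fin 2) ℂ)),
            x ∈ Ω (K' - n) ∧ (∀ b : PBond (F.P K') 0, IsSelfAdjoint (A b)) ∧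
            (∀ j, j ≤ K' - n → ∀ (z : B7Prop1Explicit.Site (F.P K').d) (μ : Fin (F.P K').d), SideTouches (pullDom Ω j) z μ →
              mgauge (cfgPull (F.P K') 1) (gaugePull (F.P K') u)⁻¹ (cfgPull (F.P K') (toUField U)) z μ =
                cfgExp (((F.L : ℝ)⁻¹) ^ (K' - n)) (pull A 0) z μ) ∧
            (∀ j, j ≤ K' - n → Cond140 (F.P K').L (((F.L : ℝ)⁻¹) ^ (K' - n)) (1 / 4 * max (4 * C * B₀ * B₃ * ε₁) (ε₀ / 2) + (K₁ + K₂ + 1) * ε₀ ^ 2) j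
              (pullDom Ω j) (cfgPull (F.P K') 1) (pull A 0)) := by
  intro F hF n K hnK ε₀ ε₁ hε₁ hε₀ hε₀a hreg V hV U hU hmin x
  obtain ⟨u, A, A₁, Rm, B, hA, hchart, hdec, hnear, hfar, s₁, g₁, d₁, s₃, g₃, d₃⟩ :=
    pkg F hF n K hnK ε₀ ε₁ hε₁ hε₀ hε₀a hreg V hV U hU hmin x
  -- P2 at the cube sequence centred at `x`, with the canonical level weights
  have hAdm : Adm22 (cubeSeqMT3 F n K x ρ S M hM1) R M := adm22_cubeSeqMT3 F n K x ρ hM1 hRS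
  have hw : IsLevWeight F n K (cubeSeqMT3 F n K x ρ S M hM1)
      (fun m b => ((F.L : ℝ) ^ levOf (fun j => {y : Site (F.P K) 0 | (cubeSeqMT3 F n K x ρ S M hM1).InOm j y}) (K - n) b.src *
        ((F.L : ℝ)⁻¹) ^ (K - n)) ^ m) := fun _ _ => rfl
  obtain ⟨H, Gt, hFH, -, -, -, -, dBI, hdom, h162, hHd⟩ :=
    hP2 F hF n K hnK R M hR hM₀ ⟨aₑ, hMpow⟩ (cubeSeqMT3 F n K x ρ S M hM1) rfl hAdm _ hw
  -- the text's `H` IS the canonical `flatH`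
  have hHeq : H = flatH F n K (cubeSeqMT3 F n K x ρ S M hM1) :=
    LinearMap.ext fun X => funext fun b => (hFH X b).trans (isFlatH_flatH (F := F) (n := n) (K := K) (D := cubeSeqMT3 F n K x ρ S M hM1) X b).symm
  rw [hHeq] at hHd
  -- the per-site clause
  have hC : 0 ≤ C := by linarith
  have hε₀2 : 0 < ε₀ ^ 2 := by positivity
  exact siteClause_of_pieces hnK x ρ S M hM1 hw hdom hHd h162 hδ₀ hB₀ hB₃ hC₁ hC₁C hC₂C hε₁.le hε₀.le (by linarith) h163 le_rfl
    (by nlinarith) U u hA hchart (fun _ => rfl) hdec hnear hfar s₁ g₁ d₁ s₃ g₃ d₃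

end Member

/-! ## §2 The registered stub's text from the P2 text and the package, every block size -/

/-- **v8∕v10's `stub_halvingStep`, FULL TEXT, FROM THE P2 TEXT AND THE ANALYTIC PACKAGE AT EVERY BLOCK SIZE `L > 1`** (`Prop8LastMile.stubText_of_localCharts167` ∘
`H_of_package`; print's `B₃ = 4CB₀B₃ > 4` from `1 < CB₀B₃`, `K = K₁ + K₂ + 1 ≥ 0`, `a > 0`). [cite: Balaban1985Variational, Sect. F p.304 before Prop. 8, (162)-(167) pp.303-304] -/
theorem stubText_of_package
    (h : ∀ L : ℕ, 1 < L → ∃ (R₀ M₀ : ℕ) (B₀ δ₀ B₃ : ℝ), 0 ≤ B₀ ∧ 0 ≤ δ₀ ∧ 0 ≤ B₃ ∧ FlatOpsAdmAtMS L R₀ M₀ B₀ δ₀ B₃ ∧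
      ∃ (R M aₑ ρ S : ℕ) (hM1 : 1 ≤ M) (C C₁ C₂ K₁ K₂ a : ℝ), R₀ ≤ R ∧ M₀ ≤ M ∧ M = L ^ aₑ ∧ R * M ≤ S ∧ (2 : ℝ) ≤ (ρ : ℝ) ∧
        0 ≤ C₁ ∧ 2 * C₁ ≤ C ∧ C₂ ≤ C ∧ 0 ≤ K₁ ∧ 0 ≤ K₂ ∧ 0 < a ∧ 1 < C * B₀ * B₃ ∧
        4 * C * B₀ * B₃ * Real.exp (-(δ₀ / 2 * ((ρ : ℝ) - 2))) ≤ 1 / 2 ∧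
        ∀ F : T3Family, F.L = L → ∀ (n K : ℕ) (hnK : n < K) (ε₀ ε₁ : ℝ), 0 < ε₁ → 0 < ε₀ → ε₀ ≤ a → 4 * C * B₀ * B₃ * ε₁ < ε₀ →
          ∀ V : GaugeField (F.P n) 0 (Matrix.specialUnitaryGroup (Fin 2) ℂ), PlaqSmall ε₁ V →
            ∀ U ∈ regFibrePr F n K hnK.le ε₀ V,
              IsMinOn (fun W : GaugeField (F.P K) 0 (Matrix.specialUnitaryGroup (Fin 2) ℂ) => wilsonAction4 W) (regFibrePr F n K hnK.le ε₀ V) U →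
              ∀ x : Site (F.P K) 0,
                ∃ (u : GaugeTransf (F.P K) 0 (Matrix.unitaryGroup (Fin 2) ℂ)) (A A₁ R : PBond (F.P K) 0 → Matrix (Fin 2) (Fin 2) ℂ)
                  (B : BondIdx (cubeSeqMT3 F n K x ρ S M hM1) → Matrix (Fin 2) (Fin 2) ℂ),
                  (∀ b : PBond (F.P K) 0, IsSelfAdjoint (A b)) ∧
                  (∀ (z : B7Prop1Explicit.Site (F.P K).d) (μ : Fin (F.P K).d),
                    SideTouches (pullDom (fun j => if K - n ≤ j then ({x} : Set (Site (F.P K) 0)) else (∅ : Set (Site (F.P K) 0))) (K - n)) z μ →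
                    (Unitary.toUnits (u (transl 0 z)))⁻¹ * unitsField (toUField U) ⟨transl 0 z, μ⟩ * Unitary.toUnits (u ((transl 0 z).shift μ)) =
                      expUnit (I • ((((F.L : ℝ)⁻¹) ^ (K - n)) • A ⟨transl 0 z, μ⟩))) ∧
                  (A = A₁ + (fun b => ∑ c, flatH F n K (cubeSeqMT3 F n K x ρ S M hM1) (Pi.single c 1) b • B c) - R) ∧
                  (∀ c : BondIdx (cubeSeqMT3 F n K x ρ S M hM1), (c.1.1 : ℕ) = K - n →
                    ‖B c‖ ≤ C₁ * ε₁ * (distSite (Mk (F.P K) (c.1.1 : ℕ)) c.1.2.src (iterBlockOf (c.1.1 : ℕ) x) + 1)) ∧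
                  (∀ c : BondIdx (cubeSeqMT3 F n K x ρ S M hM1), (c.1.1 : ℕ) < K - n →
                    ‖B c‖ ≤ C₂ * ε₀ * (F.L : ℝ) ^ ((K - n) - (c.1.1 : ℕ))) ∧
                  (∀ (z : B7Prop1Explicit.Site (F.P K).d) (τ : Fin (F.P K).d),
                    SideTouches (pullDom (fun j => if K - n ≤ j then ({x} : Set (Site (F.P K) 0)) else (∅ : Set (Site (F.P K) 0))) (K - n)) z τ →
                    ‖A₁ ⟨transl 0 z, τ⟩‖ ≤ K₁ * ε₀ ^ 2) ∧
                  (∀ (z : B7Prop1Explicit.Site (F.P K).d) (κ τ : Fin (F.P K).d),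
                    SideTouches (pullDom (fun j => if K - n ≤ j then ({x} : Set (Site (F.P K) 0)) else (∅ : Set (Site (F.P K) 0))) (K - n)) z τ →
                    ‖(((F.L : ℝ)⁻¹) ^ (K - n))⁻¹ • (A₁ ⟨(transl 0 z).shift κ, τ⟩ - A₁ ⟨transl 0 z, τ⟩)‖ ≤ K₁ * ε₀ ^ 2) ∧
                  (∀ (z : B7Prop1Explicit.Site (F.P K).d) (μ : Fin (F.P K).d),
                    BondTouches (pullDom (fun j => if K - n ≤ j then ({x} : Set (Site (F.P K) 0)) else (∅ : Set (Site (F.P K) 0))) (K - n)) z μ →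
                    ‖pdiv (((F.L : ℝ)⁻¹) ^ (K - n)) (1 : B7Prop1Explicit.Site (F.P K).d → Fin (F.P K).d → (Matrix (Fin 2) (Fin 2) ℂ)ˣ)
                        (plaqCovDeriv (((F.L : ℝ)⁻¹) ^ (K - n)) (1 : B7Prop1Explicit.Site (F.P K).d → Fin (F.P K).d → (Matrix (Fin 2) (Fin 2) ℂ)ˣ)
                          (pull A₁ 0)) μ z‖ ≤ K₁ * ε₀ ^ 2) ∧
                  (∀ (z : B7Prop1Explicit.Site (F.P K).d) (τ : Fin (F.P K).d),
                    SideTouches (pullDom (fun j => if K - n ≤ j then ({x} : Set (Site (F.P K) 0)) else (∅ : Set (Site (F.P K) 0))) (K - n)) z τ →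
                    ‖R ⟨transl 0 z, τ⟩‖ ≤ K₂ * ε₀ ^ 2) ∧
                  (∀ (z : B7Prop1Explicit.Site (F.P K).d) (κ τ : Fin (F.P K).d),
                    SideTouches (pullDom (fun j => if K - n ≤ j then ({x} : Set (Site (F.P K) 0)) else (∅ : Set (Site (F.P K) 0))) (K - n)) z τ →
                    ‖(((F.L : ℝ)⁻¹) ^ (K - n))⁻¹ • (R ⟨(transl 0 z).shift κ, τ⟩ - R ⟨transl 0 z, τ⟩)‖ ≤ K₂ * ε₀ ^ 2) ∧
                  (∀ (z : B7Prop1Explicit.Site (F.P K).d) (μ : Fin (F.P K).d),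
                    BondTouches (pullDom (fun j => if K - n ≤ j then ({x} : Set (Site (F.P K) 0)) else (∅ : Set (Site (F.P K) 0))) (K - n)) z μ →
                    ‖pdiv (((F.L : ℝ)⁻¹) ^ (K - n)) (1 : B7Prop1Explicit.Site (F.P K).d → Fin (F.P K).d → (Matrix (Fin 2) (Fin 2) ℂ)ˣ)
                        (plaqCovDeriv (((F.L : ℝ)⁻¹) ^ (K - n)) (1 : B7Prop1Explicit.Site (F.P K).d → Fin (F.P K).d → (Matrix (Fin 2) (Fin 2) ℂ)ˣ)
                          (pull R 0)) μ z‖ ≤ K₂ * ε₀ ^ 2)) :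
    ∀ (L : ℕ), 1 < L → ∃ B₃ : ℝ, 4 < B₃ ∧ ∃ a₅ : ℝ, 0 < a₅ ∧
      ∀ (i : Idx L) (ε₀ ε₁ : ℝ), 0 < ε₁ → ∀ (V : (famX L i).Bdry) (U : (famX L i).Cfg), (famX L i).Reg7 ε₁ V → (famX L i).InU ε₀ U →
        (famX L i).InB V U → (famX L i).IsCritical V U → ε₀ ≤ a₅ → (famX L i).InU (max (B₃ * ε₁) (ε₀ / 2)) U := by
  refine Prop8LastMile.stubText_of_localCharts167 fun L hL => ?_
  obtain ⟨R₀, M₀, B₀, δ₀, B₃, hB₀, hδ₀, hB₃, hP2, R, M, aₑ, ρ, S, hM1, C, C₁, C₂, K₁, K₂, a, hR, hM₀, hMpow, hRS, hρ2, hC₁, hC₁C, hC₂C, hK₁, hK₂,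
    ha, hbig, h163, pkg⟩ := h L hL
  refine ⟨4 * C * B₀ * B₃, by nlinarith, K₁ + K₂ + 1, by positivity, a, ha, ?_⟩
  exact H_of_package hP2 hB₀ hδ₀ hB₃ hR hM₀ hMpow hM1 hRS hρ2 hC₁ hC₁C hC₂C h163 pkg

/-- **PROPOSITION 8 AT THE CARRIERS FROM THE P2 TEXT AND THE PACKAGE** (v8's `landed_prop8` line through p1 g14's iteration `Prop8Iter.prop8_of_halvingLiteral`).
[cite: Balaban1985Variational, Prop. 8 p.304] -/
theorem prop8_of_package
    (h : ∀ L : ℕ, 1 < L → ∃ (R₀ M₀ : ℕ) (B₀ δ₀ B₃ : ℝ), 0 ≤ B₀ ∧ 0 ≤ δ₀ ∧ 0 ≤ B₃ ∧ FlatOpsAdmAtMS L R₀ M₀ B₀ δ₀ B₃ ∧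
      ∃ (R M aₑ ρ S : ℕ) (hM1 : 1 ≤ M) (C C₁ C₂ K₁ K₂ a : ℝ), R₀ ≤ R ∧ M₀ ≤ M ∧ M = L ^ aₑ ∧ R * M ≤ S ∧ (2 : ℝ) ≤ (ρ : ℝ) ∧
        0 ≤ C₁ ∧ 2 * C₁ ≤ C ∧ C₂ ≤ C ∧ 0 ≤ K₁ ∧ 0 ≤ K₂ ∧ 0 < a ∧ 1 < C * B₀ * B₃ ∧
        4 * C * B₀ * B₃ * Real.exp (-(δ₀ / 2 * ((ρ : ℝ) - 2))) ≤ 1 / 2 ∧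
        ∀ F : T3Family, F.L = L → ∀ (n K : ℕ) (hnK : n < K) (ε₀ ε₁ : ℝ), 0 < ε₁ → 0 < ε₀ → ε₀ ≤ a → 4 * C * B₀ * B₃ * ε₁ < ε₀ →
          ∀ V : GaugeField (F.P n) 0 (Matrix.specialUnitaryGroup (Fin 2) ℂ), PlaqSmall ε₁ V →
            ∀ U ∈ regFibrePr F n K hnK.le ε₀ V,
              IsMinOn (fun W : GaugeField (F.P K) 0 (Matrix.specialUnitaryGroup (Fin 2) ℂ) => wilsonAction4 W) (regFibrePr F n K hnK.le ε₀ V) U →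
              ∀ x : Site (F.P K) 0,
                ∃ (u : GaugeTransf (F.P K) 0 (Matrix.unitaryGroup (Fin 2) ℂ)) (A A₁ R : PBond (F.P K) 0 → Matrix (Fin 2) (Fin 2) ℂ)
                  (B : BondIdx (cubeSeqMT3 F n K x ρ S M hM1) → Matrix (Fin 2) (Fin 2) ℂ),
                  (∀ b : PBond (F.P K) 0, IsSelfAdjoint (A b)) ∧
                  (∀ (z : B7Prop1Explicit.Site (F.P K).d) (μ : Fin (F.P K).d),
                    SideTouches (pullDom (fun j => if K - n ≤ j then ({x} : Set (Site (F.P K) 0)) else (∅ : Set (Site (F.P K) 0))) (K - n)) z μ →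
                    (Unitary.toUnits (u (transl 0 z)))⁻¹ * unitsField (toUField U) ⟨transl 0 z, μ⟩ * Unitary.toUnits (u ((transl 0 z).shift μ)) =
                      expUnit (I • ((((F.L : ℝ)⁻¹) ^ (K - n)) • A ⟨transl 0 z, μ⟩))) ∧
                  (A = A₁ + (fun b => ∑ c, flatH F n K (cubeSeqMT3 F n K x ρ S M hM1) (Pi.single c 1) b • B c) - R) ∧
                  (∀ c : BondIdx (cubeSeqMT3 F n K x ρ S M hM1), (c.1.1 : ℕ) = K - n →
                    ‖B c‖ ≤ C₁ * ε₁ * (distSite (Mk (F.P K) (c.1.1 : ℕ)) c.1.2.src (iterBlockOf (c.1.1 : ℕ) x) + 1)) ∧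
                  (∀ c : BondIdx (cubeSeqMT3 F n K x ρ S M hM1), (c.1.1 : ℕ) < K - n →
                    ‖B c‖ ≤ C₂ * ε₀ * (F.L : ℝ) ^ ((K - n) - (c.1.1 : ℕ))) ∧
                  (∀ (z : B7Prop1Explicit.Site (F.P K).d) (τ : Fin (F.P K).d),
                    SideTouches (pullDom (fun j => if K - n ≤ j then ({x} : Set (Site (F.P K) 0)) else (∅ : Set (Site (F.P K) 0))) (K - n)) z τ →
                    ‖A₁ ⟨transl 0 z, τ⟩‖ ≤ K₁ * ε₀ ^ 2) ∧
                  (∀ (z : B7Prop1Explicit.Site (F.P K).d) (κ τ : Fin (F.P K).d),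
                    SideTouches (pullDom (fun j => if K - n ≤ j then ({x} : Set (Site (F.P K) 0)) else (∅ : Set (Site (F.P K) 0))) (K - n)) z τ →
                    ‖(((F.L : ℝ)⁻¹) ^ (K - n))⁻¹ • (A₁ ⟨(transl 0 z).shift κ, τ⟩ - A₁ ⟨transl 0 z, τ⟩)‖ ≤ K₁ * ε₀ ^ 2) ∧
                  (∀ (z : B7Prop1Explicit.Site (F.P K).d) (μ : Fin (F.P K).d),
                    BondTouches (pullDom (fun j => if K - n ≤ j then ({x} : Set (Site (F.P K) 0)) else (∅ : Set (Site (F.P K) 0))) (K - n)) z μ →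
                    ‖pdiv (((F.L : ℝ)⁻¹) ^ (K - n)) (1 : B7Prop1Explicit.Site (F.P K).d → Fin (F.P K).d → (Matrix (Fin 2) (Fin 2) ℂ)ˣ)
                        (plaqCovDeriv (((F.L : ℝ)⁻¹) ^ (K - n)) (1 : B7Prop1Explicit.Site (F.P K).d → Fin (F.P K).d → (Matrix (Fin 2) (Fin 2) ℂ)ˣ)
                          (pull A₁ 0)) μ z‖ ≤ K₁ * ε₀ ^ 2) ∧
                  (∀ (z : B7Prop1Explicit.Site (F.P K).d) (τ : Fin (F.P K).d),
                    SideTouches (pullDom (fun j => if K - n ≤ j then ({x} : Set (Site (F.P K) 0)) else (∅ : Set (Site (F.P K) 0))) (K - n)) z τ →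
                    ‖R ⟨transl 0 z, τ⟩‖ ≤ K₂ * ε₀ ^ 2) ∧
                  (∀ (z : B7Prop1Explicit.Site (F.P K).d) (κ τ : Fin (F.P K).d),
                    SideTouches (pullDom (fun j => if K - n ≤ j then ({x} : Set (Site (F.P K) 0)) else (∅ : Set (Site (F.P K) 0))) (K - n)) z τ →
                    ‖(((F.L : ℝ)⁻¹) ^ (K - n))⁻¹ • (R ⟨(transl 0 z).shift κ, τ⟩ - R ⟨transl 0 z, τ⟩)‖ ≤ K₂ * ε₀ ^ 2) ∧
                  (∀ (z : B7Prop1Explicit.Site (F.P K).d) (μ : Fin (F.P K).d),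
                    BondTouches (pullDom (fun j => if K - n ≤ j then ({x} : Set (Site (F.P K) 0)) else (∅ : Set (Site (F.P K) 0))) (K - n)) z μ →
                    ‖pdiv (((F.L : ℝ)⁻¹) ^ (K - n)) (1 : B7Prop1Explicit.Site (F.P K).d → Fin (F.P K).d → (Matrix (Fin 2) (Fin 2) ℂ)ˣ)
                        (plaqCovDeriv (((F.L : ℝ)⁻¹) ^ (K - n)) (1 : B7Prop1Explicit.Site (F.P K).d → Fin (F.P K).d → (Matrix (Fin 2) (Fin 2) ℂ)ˣ)
                          (pull R 0)) μ z‖ ≤ K₂ * ε₀ ^ 2)) :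
    ∀ L : ℕ, 1 < L → ∃ B₃ : ℝ, 4 < B₃ ∧ Prop8Printed B₃ (famX L) :=
  Prop8Iter.prop8_of_halvingLiteral (stubText_of_package h)

/-! ## §3 (v1.1, append-only) The radius of (163) chosen here: the socket reads «package for all large `ρ`» -/

/-- **(163) IS A CHOICE OF `R₁M₁`**: for `δ₀ > 0` and `T ≥ 0` there is an integer radius `ρ ≥ 2` with `T·e^{−½δ₀(ρ−2)} ≤ ½` (print: «We may assume that R₁M₁ is
sufficiently big, so that B₃e^{−½δ₀R₁M₁} ≦ ½»; `ρ = ⌈2 + 4T/δ₀⌉`, `e^{−y} ≤ 1/(1 + y)`). [cite: Balaban1985Variational, (163) p.303] -/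
theorem exists_rho_163 {δ₀ T : ℝ} (hδ₀ : 0 < δ₀) (hT : 0 ≤ T) :
    ∃ ρ : ℕ, (2 : ℝ) ≤ (ρ : ℝ) ∧ T * Real.exp (-(δ₀ / 2 * ((ρ : ℝ) - 2))) ≤ 1 / 2 := by
  refine ⟨⌈2 + 4 * T / δ₀⌉₊, ?_, ?_⟩
  · have h := Nat.le_ceil (2 + 4 * T / δ₀)
    have : (0 : ℝ) ≤ 4 * T / δ₀ := by positivity
    linarith
  · set ρ : ℕ := ⌈2 + 4 * T / δ₀⌉₊ with hρ
    have hge : 2 + 4 * T / δ₀ ≤ (ρ : ℝ) := Nat.le_ceil _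
    have hy : 0 ≤ δ₀ / 2 * ((ρ : ℝ) - 2) := by
      have : (0 : ℝ) ≤ 4 * T / δ₀ := by positivity
      have : (2 : ℝ) ≤ ρ := by linarith
      positivity
    have hexp : Real.exp (-(δ₀ / 2 * ((ρ : ℝ) - 2))) ≤ 1 / (1 + δ₀ / 2 * ((ρ : ℝ) - 2)) := by
      rw [Real.exp_neg, one_div]
      exact inv_anti₀ (by positivity) (by linarith [Real.add_one_le_exp (δ₀ / 2 * ((ρ : ℝ) - 2))])
    have h2T : 2 * T ≤ δ₀ / 2 * ((ρ : ℝ) - 2) := by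
      have : 4 * T / δ₀ ≤ (ρ : ℝ) - 2 := by linarith
      have h := mul_le_mul_of_nonneg_left this (by positivity : 0 ≤ δ₀ / 2)
      have : δ₀ / 2 * (4 * T / δ₀) = 2 * T := by field_simp; ring
      linarith
    calc T * Real.exp (-(δ₀ / 2 * ((ρ : ℝ) - 2))) ≤ T * (1 / (1 + δ₀ / 2 * ((ρ : ℝ) - 2))) :=
          mul_le_mul_of_nonneg_left hexp hT
      _ ≤ 1 / 2 := by
          rw [mul_one_div, div_le_iff₀ (by positivity)]
          linarith

/-- **THE REGISTERED TEXT FROM THE P2 TEXT AND THE PACKAGE AT EVERY LARGE RADIUS** — the form the pillar pens should target: the P2 text with `δ₀ > 0`, the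
constants, and the analytic package for EVERY inner radius `ρ ≥ 2` of the cube sequence (print's Thm 2 / Sect. F work at any `R₁M₁`); (163) is then a
choice made here (`exists_rho_163` with `T = 4CB₀B₃`). [cite: Balaban1985Variational, (162)-(163) p.303, Sect. F p.304 before Prop. 8] -/
theorem stubText_of_package_largeRho
    (h : ∀ L : ℕ, 1 < L → ∃ (R₀ M₀ : ℕ) (B₀ δ₀ B₃ : ℝ), 0 ≤ B₀ ∧ 0 < δ₀ ∧ 0 ≤ B₃ ∧ FlatOpsAdmAtMS L R₀ M₀ B₀ δ₀ B₃ ∧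
      ∃ (R M aₑ S : ℕ) (hM1 : 1 ≤ M) (C C₁ C₂ K₁ K₂ a : ℝ), R₀ ≤ R ∧ M₀ ≤ M ∧ M = L ^ aₑ ∧ R * M ≤ S ∧
        0 ≤ C₁ ∧ 2 * C₁ ≤ C ∧ C₂ ≤ C ∧ 0 ≤ K₁ ∧ 0 ≤ K₂ ∧ 0 < a ∧ 1 < C * B₀ * B₃ ∧
        ∀ ρ : ℕ, (2 : ℝ) ≤ (ρ : ℝ) →
          ∀ F : T3Family, F.L = L → ∀ (n K : ℕ) (hnK : n < K) (ε₀ ε₁ : ℝ), 0 < ε₁ → 0 < ε₀ → ε₀ ≤ a → 4 * C * B₀ * B₃ * ε₁ < ε₀ →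
            ∀ V : GaugeField (F.P n) 0 (Matrix.specialUnitaryGroup (Fin 2) ℂ), PlaqSmall ε₁ V →
              ∀ U ∈ regFibrePr F n K hnK.le ε₀ V,
                IsMinOn (fun W : GaugeField (F.P K) 0 (Matrix.specialUnitaryGroup (Fin 2) ℂ) => wilsonAction4 W) (regFibrePr F n K hnK.le ε₀ V) U →
                ∀ x : Site (F.P K) 0,
                  ∃ (u : GaugeTransf (F.P K) 0 (Matrix.unitaryGroup (Fin 2) ℂ)) (A A₁ R : PBond (F.P K) 0 → Matrix (Fin 2) (Fin 2) ℂ)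
                    (B : BondIdx (cubeSeqMT3 F n K x ρ S M hM1) → Matrix (Fin 2) (Fin 2) ℂ),
                    (∀ b : PBond (F.P K) 0, IsSelfAdjoint (A b)) ∧
                    (∀ (z : B7Prop1Explicit.Site (F.P K).d) (μ : Fin (F.P K).d),
                      SideTouches (pullDom (fun j => if K - n ≤ j then ({x} : Set (Site (F.P K) 0)) else (∅ : Set (Site (F.P K) 0))) (K - n)) z μ →
                      (Unitary.toUnits (u (transl 0 z)))⁻¹ * unitsField (toUField U) ⟨transl 0 z, μ⟩ * Unitary.toUnits (u ((transl 0 z).shift μ)) =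
                        expUnit (I • ((((F.L : ℝ)⁻¹) ^ (K - n)) • A ⟨transl 0 z, μ⟩))) ∧
                    (A = A₁ + (fun b => ∑ c, flatH F n K (cubeSeqMT3 F n K x ρ S M hM1) (Pi.single c 1) b • B c) - R) ∧
                    (∀ c : BondIdx (cubeSeqMT3 F n K x ρ S M hM1), (c.1.1 : ℕ) = K - n →
                      ‖B c‖ ≤ C₁ * ε₁ * (distSite (Mk (F.P K) (c.1.1 : ℕ)) c.1.2.src (iterBlockOf (c.1.1 : ℕ) x) + 1)) ∧
                    (∀ c : BondIdx (cubeSeqMT3 F n K x ρ S M hM1), (c.1.1 : ℕ) < K - n →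
                      ‖B c‖ ≤ C₂ * ε₀ * (F.L : ℝ) ^ ((K - n) - (c.1.1 : ℕ))) ∧
                    (∀ (z : B7Prop1Explicit.Site (F.P K).d) (τ : Fin (F.P K).d),
                      SideTouches (pullDom (fun j => if K - n ≤ j then ({x} : Set (Site (F.P K) 0)) else (∅ : Set (Site (F.P K) 0))) (K - n)) z τ →
                      ‖A₁ ⟨transl 0 z, τ⟩‖ ≤ K₁ * ε₀ ^ 2) ∧
                    (∀ (z : B7Prop1Explicit.Site (F.P K).d) (κ τ : Fin (F.P K).d),
                      SideTouches (pullDom (fun j => if K - n ≤ j then ({x} : Set (Site (F.P K) 0)) else (∅ : Set (Site (F.P K) 0))) (K - n)) z τ →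
                      ‖(((F.L : ℝ)⁻¹) ^ (K - n))⁻¹ • (A₁ ⟨(transl 0 z).shift κ, τ⟩ - A₁ ⟨transl 0 z, τ⟩)‖ ≤ K₁ * ε₀ ^ 2) ∧
                    (∀ (z : B7Prop1Explicit.Site (F.P K).d) (μ : Fin (F.P K).d),
                      BondTouches (pullDom (fun j => if K - n ≤ j then ({x} : Set (Site (F.P K) 0)) else (∅ : Set (Site (F.P K) 0))) (K - n)) z μ →
                      ‖pdiv (((F.L : ℝ)⁻¹) ^ (K - n)) (1 : B7Prop1Explicit.Site (F.P K).d → Fin (F.P K).d → (Matrix (Fin 2) (Fin 2) ℂ)ˣ)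
                          (plaqCovDeriv (((F.L : ℝ)⁻¹) ^ (K - n)) (1 : B7Prop1Explicit.Site (F.P K).d → Fin (F.P K).d → (Matrix (Fin 2) (Fin 2) ℂ)ˣ)
                            (pull A₁ 0)) μ z‖ ≤ K₁ * ε₀ ^ 2) ∧
                    (∀ (z : B7Prop1Explicit.Site (F.P K).d) (τ : Fin (F.P K).d),
                      SideTouches (pullDom (fun j => if K - n ≤ j then ({x} : Set (Site (F.P K) 0)) else (∅ : Set (Site (F.P K) 0))) (K - n)) z τ →
                      ‖R ⟨transl 0 z, τ⟩‖ ≤ K₂ * ε₀ ^ 2) ∧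
                    (∀ (z : B7Prop1Explicit.Site (F.P K).d) (κ τ : Fin (F.P K).d),
                      SideTouches (pullDom (fun j => if K - n ≤ j then ({x} : Set (Site (F.P K) 0)) else (∅ : Set (Site (F.P K) 0))) (K - n)) z τ →
                      ‖(((F.L : ℝ)⁻¹) ^ (K - n))⁻¹ • (R ⟨(transl 0 z).shift κ, τ⟩ - R ⟨transl 0 z, τ⟩)‖ ≤ K₂ * ε₀ ^ 2) ∧
                    (∀ (z : B7Prop1Explicit.Site (F.P K).d) (μ : Fin (F.P K).d),
                      BondTouches (pullDom (fun j => if K - n ≤ j then ({x} : Set (Site (F.P K) 0)) else (∅ : Set (Site (F.P K) 0))) (K - n)) z μ →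
                      ‖pdiv (((F.L : ℝ)⁻¹) ^ (K - n)) (1 : B7Prop1Explicit.Site (F.P K).d → Fin (F.P K).d → (Matrix (Fin 2) (Fin 2) ℂ)ˣ)
                          (plaqCovDeriv (((F.L : ℝ)⁻¹) ^ (K - n)) (1 : B7Prop1Explicit.Site (F.P K).d → Fin (F.P K).d → (Matrix (Fin 2) (Fin 2) ℂ)ˣ)
                            (pull R 0)) μ z‖ ≤ K₂ * ε₀ ^ 2)) :
    ∀ (L : ℕ), 1 < L → ∃ B₃ : ℝ, 4 < B₃ ∧ ∃ a₅ : ℝ, 0 < a₅ ∧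
      ∀ (i : Idx L) (ε₀ ε₁ : ℝ), 0 < ε₁ → ∀ (V : (famX L i).Bdry) (U : (famX L i).Cfg), (famX L i).Reg7 ε₁ V → (famX L i).InU ε₀ U →
        (famX L i).InB V U → (famX L i).IsCritical V U → ε₀ ≤ a₅ → (famX L i).InU (max (B₃ * ε₁) (ε₀ / 2)) U := by
  refine stubText_of_package fun L hL => ?_
  obtain ⟨R₀, M₀, B₀, δ₀, B₃, hB₀, hδ₀, hB₃, hP2, R, M, aₑ, S, hM1, C, C₁, C₂, K₁, K₂, a, hR, hM₀, hMpow, hRS, hC₁, hC₁C, hC₂C, hK₁, hK₂,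
    ha, hbig, pkg⟩ := h L hL
  have hC : 0 ≤ C := by linarith
  obtain ⟨ρ, hρ2, h163⟩ := exists_rho_163 hδ₀ (by positivity : (0 : ℝ) ≤ 4 * C * B₀ * B₃)
  exact ⟨R₀, M₀, B₀, δ₀, B₃, hB₀, hδ₀.le, hB₃, hP2, R, M, aₑ, ρ, S, hM1, C, C₁, C₂, K₁, K₂, a, hR, hM₀, hMpow, hRS, hρ2, hC₁, hC₁C, hC₂C, hK₁,
    hK₂, ha, hbig, h163, pkg ρ hρ2⟩

end Summit.QuantumFields.YangMills.Theorems.HalvingAssembly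

end
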